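import Summits.Ventures.CertifiedManyBodySolver.Observables.StiffnessObliqueStation
import Literature.MathematicalPhysics.QuantumLattice.HubbardNNNHoppingEnergyDensityRegionBounds
import HarnessLib

/-!
# Ventures/CertifiedManyBodySolver — Observables/StiffnessObliqueStationRayCaps.lean

HONEST FRAMING: a CAP device for the «OBLIQUE STATION» line (hubbard-fast-reuse-2 g11; `Observables/StiffnessObliqueStation.lean`): certified energy CAPS
on a `(U, t′)`-box obtained by JOINT concavity of `(t′, U) ↦ e(1, t′, U, n)` (`Literature/…/HubbardNNNHoppingEnergyDensityRegionBounds`: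
`energyDensityTT'_le_extrapolate_line`) — the chord from a certified FLOOR point `P₁ = (s₁, U₁)` to a point `P₂ = (t₂, U₂)` on a `t′`-affine CAP LINE at
coupling `U₂`, extrapolated beyond `P₂`. No observable, no stiffness word, no claim node, no definition, no `sorry`; not a superconductivity or `T_c` verdict;
NO summit statement is proved by this seat. Zero compute.

THE POINT. g10's secant caps extrapolate in `U` at FIXED `t′`; above the last cap of a doped density the only cap line with a certified `t′`-slope is the
`(8, 7/8)` column (`hi₅₅₀ + B₈t′` for `t′ ≤ 0`, and `#596 + (t′ + ¼)B₈` for `t′ ≤ −¼`), so a fixed-`t′` secant at `t′ ∈ (−¼, 0)` starts from the loose plane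
value in the «cap valley». Along an OBLIQUE ray from a low-coupling oblique floor `P₁ = (s₁, U₁)` (`s₁ < −¼`) the chord crosses the `U₂ = 8` column at
`t₂ = (t′ + θs₁)/(1 + θ) ≤ −¼` (`θ = (U − U₂)/(U₂ − U₁)`), where the cap is the good anchor plane, and lands at the target `(t′, U)` with `t′ > −¼`:
`e(1, t′, U, n) ≤ (1 + θ)(c₀ + c₁t₂) − θL₁ = c₀ + c₁t′ + θ(c₀ + c₁s₁ − L₁)` — AFFINE in `(U, t′)`, so it is a `hcapbox` of the line's box theorems
(`h₃ = 0`). The mirror case (`U₁ > U₂ ≥ U`, a floor ABOVE the cap column, e.g. the `U = 12` corner floors) caps the wedge below the column.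

* `rayCap_affine_at` — pointwise, any `θ ≥ 0` written out; `rayCapRight_affine_on_box` (`U₁ < U₂ ≤ U_l`), `rayCapLeft_affine_on_box` (`U_r ≤ U₂ < U₁`):
  the validity `t′(U₂ − U₁) + (U − U₂)s₁ ≤ s_max(U − U₁)` (resp. with signs flipped) is affine, checked at the four corners.

References: R. B. Israel, Convexity in the Theory of Lattice Gases (1979), Thm. I.3.4 [Israel1979]; R. B. Griffiths, J. Math. Phys. 7 (1966) 1215, §II [Griffiths1966].
-/

noncomputable section

namespace Summit.Ventures.CertifiedManyBodySolver.Observables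

open Literature.MathematicalPhysics.QuantumLattice
open Literature.MathematicalPhysics.QuantumLattice.ThermodynamicLimit

section Ray

variable {n : ℝ}

/-- **RAY CAP at a point (joint concavity).** Floor `L₁ ≤ e(1, s₁, U₁, n)` (`U₁ ≥ 0`), a cap line at coupling `U₂`: `e(1, s, U₂, n) ≤ c₀ + c₁s` for `s ≤ s_max`;
a target `(t′, U)` with `U ≥ 0` written as `U = U₂ + θ(U₂ − U₁)`, `θ ≥ 0`, whose chord point `t₂` (`(1 + θ)t₂ = t′ + θs₁`) satisfies `t₂ ≤ s_max`. Then
`e(1, t′, U, n) ≤ c₀ + c₁t′ + θ(c₀ + c₁s₁ − L₁)` (`energyDensityTT'_le_extrapolate_line`). [cite: Israel1979, Thm. I.3.4] -/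
theorem rayCap_affine_at (hn0 : 0 ≤ n) (hn2 : n < 2) {s₁ U₁ L₁ U₂ c₀ c₁ smax θ t U : ℝ} (hU₁ : 0 ≤ U₁) (hθ : 0 ≤ θ)
    (hL₁ : L₁ ≤ energyDensityTT' 1 s₁ U₁ n) (hcap : ∀ s, s ≤ smax → energyDensityTT' 1 s U₂ n ≤ c₀ + c₁ * s)
    (hU : U = U₂ + θ * (U₂ - U₁)) (hU0 : 0 ≤ U) (hvalid : t + θ * s₁ ≤ smax * (1 + θ)) :
    energyDensityTT' 1 t U n ≤ c₀ + c₁ * t + θ * (c₀ + c₁ * s₁ - L₁) := by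
  have h1θ : 0 < 1 + θ := by linarith
  set t₂ : ℝ := (t + θ * s₁) / (1 + θ) with ht₂
  have ht₂le : t₂ ≤ smax := by
    rw [ht₂, div_le_iff₀ h1θ]; linarith
  have hR₂ := hcap t₂ ht₂le
  have hU₃ : 0 ≤ U₂ + θ * (U₂ - U₁) := hU ▸ hU0
  have h := energyDensityTT'_le_extrapolate_line 1 hn0 hn2 hU₁ hθ hU₃ hL₁ hR₂
  have et : t₂ + θ * (t₂ - s₁) = t := by
    have : t₂ * (1 + θ) = t + θ * s₁ := by rw [ht₂]; exact div_mul_cancel₀ _ h1θ.ne'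
    linarith [this]
  rw [et, ← hU] at h
  have key : c₀ + c₁ * t₂ + θ * (c₀ + c₁ * t₂ - L₁) = c₀ + c₁ * t + θ * (c₀ + c₁ * s₁ - L₁) := by
    have : t₂ * (1 + θ) = t + θ * s₁ := by rw [ht₂]; exact div_mul_cancel₀ _ h1θ.ne'
    linear_combination c₁ * this
  linarith [key]

/-- **RAY CAP ON A BOX, floor BELOW the cap column** (`0 ≤ U₁ < U₂ ≤ U_l < U_r`): with `θ(U) = (U − U₂)/(U₂ − U₁)` the validity
`t′(U₂ − U₁) + (U − U₂)s₁ ≤ s_max(U − U₁)` is affine in `(U, t′)` — four corner checks — and on the box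
`e(1, t′, U, n) ≤ h₀ + h₁U + h₂t′ + 0·Ut′` with `h₁(U₂ − U₁) = c₀ + c₁s₁ − L₁`, `h₀ = c₀ − U₂h₁`, `h₂ = c₁`. [cite: Israel1979, Thm. I.3.4] -/
theorem rayCapRight_affine_on_box (hn0 : 0 ≤ n) (hn2 : n < 2) {s₁ U₁ L₁ U₂ c₀ c₁ smax h₀ h₁ h₂ Ul Ur ta tb : ℝ} (hU₁ : 0 ≤ U₁) (h12 : U₁ < U₂)
    (h2l : U₂ ≤ Ul) (hlr : Ul < Ur) (htab : ta < tb)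
    (hL₁ : L₁ ≤ energyDensityTT' 1 s₁ U₁ n) (hcap : ∀ s, s ≤ smax → energyDensityTT' 1 s U₂ n ≤ c₀ + c₁ * s)
    (hv₁ : ta * (U₂ - U₁) + (Ul - U₂) * s₁ ≤ smax * (Ul - U₁)) (hv₂ : tb * (U₂ - U₁) + (Ul - U₂) * s₁ ≤ smax * (Ul - U₁))
    (hv₃ : ta * (U₂ - U₁) + (Ur - U₂) * s₁ ≤ smax * (Ur - U₁)) (hv₄ : tb * (U₂ - U₁) + (Ur - U₂) * s₁ ≤ smax * (Ur - U₁))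
    (hh₁ : h₁ * (U₂ - U₁) = c₀ + c₁ * s₁ - L₁) (hh₀ : h₀ = c₀ - U₂ * h₁) (hh₂ : h₂ = c₁) :
    ∀ U ∈ Set.Icc Ul Ur, ∀ t ∈ Set.Icc ta tb, energyDensityTT' 1 t U n ≤ h₀ + h₁ * U + h₂ * t + 0 * U * t := by
  intro U hU t ht
  have hd : 0 < U₂ - U₁ := sub_pos.2 h12
  have hUge : U₂ ≤ U := h2l.trans hU.1
  have hU0 : 0 ≤ U := hU₁.trans (h12.le.trans hUge)
  set θ : ℝ := (U - U₂) / (U₂ - U₁) with hθdef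
  have hθ : 0 ≤ θ := div_nonneg (sub_nonneg.2 hUge) hd.le
  have hθd : θ * (U₂ - U₁) = U - U₂ := div_mul_cancel₀ _ hd.ne'
  have hUeq : U = U₂ + θ * (U₂ - U₁) := by linarith [hθd]
  -- validity at (U, t) from the four corners (affine in U and in t)
  have hpos : 0 < (Ur - Ul) * (tb - ta) := mul_pos (sub_pos.2 hlr) (sub_pos.2 htab)
  have hvI := box_corner_interp hU ht (sub_nonneg.2 hv₁) (sub_nonneg.2 hv₂) (sub_nonneg.2 hv₃) (sub_nonneg.2 hv₄)
  have keyv : (Ur - Ul) * (tb - ta) * (smax * (U - U₁) - (t * (U₂ - U₁) + (U - U₂) * s₁)) =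
      (Ur - U) * (tb - t) * (smax * (Ul - U₁) - (ta * (U₂ - U₁) + (Ul - U₂) * s₁)) + (Ur - U) * (t - ta) * (smax * (Ul - U₁) - (tb * (U₂ - U₁) + (Ul - U₂) * s₁)) +
      (U - Ul) * (tb - t) * (smax * (Ur - U₁) - (ta * (U₂ - U₁) + (Ur - U₂) * s₁)) + (U - Ul) * (t - ta) * (smax * (Ur - U₁) - (tb * (U₂ - U₁) + (Ur - U₂) * s₁)) := by ring
  have hvU : t * (U₂ - U₁) + (U - U₂) * s₁ ≤ smax * (U - U₁) := by
    have hnn : 0 ≤ (Ur - Ul) * (tb - ta) * (smax * (U - U₁) - (t * (U₂ - U₁) + (U - U₂) * s₁)) := by rw [keyv]; exact hvI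
    have := (mul_nonneg_iff_of_pos_left hpos).1 hnn
    linarith
  have hvalid : t + θ * s₁ ≤ smax * (1 + θ) := by
    -- divide the cleared validity by U₂ − U₁ > 0
    have e1 : (t + θ * s₁) * (U₂ - U₁) = t * (U₂ - U₁) + (U - U₂) * s₁ := by linear_combination s₁ * hθd
    have e2 : smax * (1 + θ) * (U₂ - U₁) = smax * (U - U₁) := by linear_combination smax * hθd
    exact le_of_mul_le_mul_right (by rw [e1, e2]; exact hvU) hd
  have h := rayCap_affine_at hn0 hn2 hU₁ hθ hL₁ hcap hUeq hU0 hvalid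
  have key : c₀ + c₁ * t + θ * (c₀ + c₁ * s₁ - L₁) = h₀ + h₁ * U + h₂ * t + 0 * U * t := by
    rw [hh₀, hh₂, ← hh₁]
    linear_combination h₁ * hθd
  linarith [key]

/-- **RAY CAP ON A BOX, floor ABOVE the cap column** (`0 ≤ U_l < U_r ≤ U₂ < U₁`): `θ(U) = (U₂ − U)/(U₁ − U₂)`; validity
`s_max(U − U₁) ≤ t′(U₂ − U₁) + (U − U₂)s₁` at the four corners (the same cleared form, inequality reversed since `U − U₁ < 0`); on the box
`e(1, t′, U, n) ≤ h₀ + h₁U + h₂t′ + 0·Ut′` with the SAME coefficients `h₁(U₂ − U₁) = c₀ + c₁s₁ − L₁`, `h₀ = c₀ − U₂h₁`, `h₂ = c₁`. [cite: Israel1979, Thm. I.3.4] -/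
theorem rayCapLeft_affine_on_box (hn0 : 0 ≤ n) (hn2 : n < 2) {s₁ U₁ L₁ U₂ c₀ c₁ smax h₀ h₁ h₂ Ul Ur ta tb : ℝ} (hUl : 0 ≤ Ul) (hlr : Ul < Ur)
    (hr2 : Ur ≤ U₂) (h21 : U₂ < U₁) (htab : ta < tb)
    (hL₁ : L₁ ≤ energyDensityTT' 1 s₁ U₁ n) (hcap : ∀ s, s ≤ smax → energyDensityTT' 1 s U₂ n ≤ c₀ + c₁ * s)
    (hv₁ : smax * (Ul - U₁) ≤ ta * (U₂ - U₁) + (Ul - U₂) * s₁) (hv₂ : smax * (Ul - U₁) ≤ tb * (U₂ - U₁) + (Ul - U₂) * s₁)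
    (hv₃ : smax * (Ur - U₁) ≤ ta * (U₂ - U₁) + (Ur - U₂) * s₁) (hv₄ : smax * (Ur - U₁) ≤ tb * (U₂ - U₁) + (Ur - U₂) * s₁)
    (hh₁ : h₁ * (U₂ - U₁) = c₀ + c₁ * s₁ - L₁) (hh₀ : h₀ = c₀ - U₂ * h₁) (hh₂ : h₂ = c₁) :
    ∀ U ∈ Set.Icc Ul Ur, ∀ t ∈ Set.Icc ta tb, energyDensityTT' 1 t U n ≤ h₀ + h₁ * U + h₂ * t + 0 * U * t := by
  intro U hU t ht
  have hd : 0 < U₁ - U₂ := sub_pos.2 h21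
  have hUle : U ≤ U₂ := hU.2.trans hr2
  have hU0 : 0 ≤ U := hUl.trans hU.1
  have hU₁ : 0 ≤ U₁ := (hU0.trans hUle).trans h21.le
  set θ : ℝ := (U₂ - U) / (U₁ - U₂) with hθdef
  have hθ : 0 ≤ θ := div_nonneg (sub_nonneg.2 hUle) hd.le
  have hθd : θ * (U₁ - U₂) = U₂ - U := div_mul_cancel₀ _ hd.ne'
  have hUeq : U = U₂ + θ * (U₂ - U₁) := by linarith [hθd]
  have hpos : 0 < (Ur - Ul) * (tb - ta) := mul_pos (sub_pos.2 hlr) (sub_pos.2 htab)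
  have hvI := box_corner_interp hU ht (sub_nonneg.2 hv₁) (sub_nonneg.2 hv₂) (sub_nonneg.2 hv₃) (sub_nonneg.2 hv₄)
  have keyv : (Ur - Ul) * (tb - ta) * ((t * (U₂ - U₁) + (U - U₂) * s₁) - smax * (U - U₁)) =
      (Ur - U) * (tb - t) * ((ta * (U₂ - U₁) + (Ul - U₂) * s₁) - smax * (Ul - U₁)) + (Ur - U) * (t - ta) * ((tb * (U₂ - U₁) + (Ul - U₂) * s₁) - smax * (Ul - U₁)) +
      (U - Ul) * (tb - t) * ((ta * (U₂ - U₁) + (Ur - U₂) * s₁) - smax * (Ur - U₁)) + (U - Ul) * (t - ta) * ((tb * (U₂ - U₁) + (Ur - U₂) * s₁) - smax * (Ur - U₁)) := by ring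
  have hvU : smax * (U - U₁) ≤ t * (U₂ - U₁) + (U - U₂) * s₁ := by
    have hnn : 0 ≤ (Ur - Ul) * (tb - ta) * ((t * (U₂ - U₁) + (U - U₂) * s₁) - smax * (U - U₁)) := by rw [keyv]; exact hvI
    have := (mul_nonneg_iff_of_pos_left hpos).1 hnn
    linarith
  have hvalid : t + θ * s₁ ≤ smax * (1 + θ) := by
    have e1 : (t + θ * s₁) * (U₁ - U₂) = -(t * (U₂ - U₁) + (U - U₂) * s₁) := by linear_combination s₁ * hθd
    have e2 : smax * (1 + θ) * (U₁ - U₂) = -(smax * (U - U₁)) := by linear_combination smax * hθd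
    exact le_of_mul_le_mul_right (by rw [e1, e2]; linarith [hvU]) hd
  have h := rayCap_affine_at hn0 hn2 hU₁ hθ hL₁ hcap hUeq hU0 hvalid
  have key : c₀ + c₁ * t + θ * (c₀ + c₁ * s₁ - L₁) = h₀ + h₁ * U + h₂ * t + 0 * U * t := by
    rw [hh₀, hh₂, ← hh₁]
    linear_combination (-h₁) * hθd
  linarith [key]

end Ray

end Summit.Ventures.CertifiedManyBodySolver.Observables

end
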